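import Mathlib
import HarnessLib
import Literature.Probability.LatticeModels.TorusFourier
import Literature.MathematicalPhysics.QuantumLattice.FermiRG.FST2VolumeBoundLemmas

/-!
# Lattice points in a sublevel set are controlled by the volume of a thickened sublevel set (cells ⊂ band)

Topic `MathematicalPhysics/QuantumLattice`; the finite-volume (lattice) reading of the regular-region volume bound of Feldman–Salmhofer–Trubowitz
1998, App. B (tree: `FermiRG.FST2VolumeBoundLemmas.volume_regular_le_of_tiling_of_hessian_bound`), i.e. the DENSITY-OF-STATES COUNT the
infrared Gram constant of the cell gate-hubbard-kl's scale-`0` step consumes (`InfraredCutoffGramConstant`: `#{|e| < η} ≤ c₁ηL² + c₂L`):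
each lattice momentum `p_k⃗ = 2πk⃗/L` with `|η(p_k⃗)| < ε` owns the half-open cell `p_k⃗ + [0, 2π/L)²`, on which `|η| ≤ ε + G·2π/L` for a
sup-metric Lipschitz constant `G` of `η`; the cells are disjoint and lie in `[0, 2π + 2π/L]²`, so
`#{k⃗ : |η(p_k⃗)| < ε} · (2π/L)² ≤ vol([0, 2π + 2π/L]² ∩ {|η| ≤ ε + 2πG/L})` (`card_filter_abs_lt_mul_le_volume`), and with the tiling
estimate, for a `C²` band REGULAR near its zero set (`|η| ≤ r ⇒ |∂₁η| ≥ 2δ₁ ∨ |∂₂η| ≥ 2δ₁`, `‖D²η‖ ≤ M`):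
`#{k⃗ : |η(p_k⃗)| < ε} · (2π/L)² ≤ n²·s·2(ε + 2πG/L)/δ₁`, `s = δ₁/(M+1)`, `n = ⌈(2π + 2π/L)/s⌉` — linear in `ε`, plus the `O(L)` rounding term
(`card_filter_abs_lt_mul_sq_le`).  Everything is PROVED; no definition, no named fact.

## Sources

J. Feldman, M. Salmhofer, E. Trubowitz, *Regularity of the moving Fermi surface: RPA contributions*, Comm. Pure Appl. Math. 51 (1998),
App. B (arXiv p.32 L88–96) [`FeldmanSalmhoferTrubowitz1998`]; W. de Siqueira Pedra, M. Salmhofer, Comm. Math. Phys. 282 (2008), Lemma 5.1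
(where the density of states enters the Gram constant) [`PedraSalmhofer2008`].
-/

noncomputable section

open Finset MeasureTheory Set

namespace Literature.MathematicalPhysics.QuantumLattice

open Literature.Probability.LatticeModels

variable {L : ℕ} [NeZero L]

/-- **Lattice points in a sublevel set versus the volume of the thickened band.**  For `η : ℝ × ℝ → ℝ` with the sup-metric Lipschitz
bound `|η p - η q| ≤ G·dist p q` and any `ε`:
`#{k⃗ ∈ (ℤ/L)² : |η(2πk⃗/L)| < ε} · (2π/L)² ≤ vol([0, 2π + 2π/L]² ∩ {|η| ≤ ε + G·2π/L})` (the finite-volume reading of the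
regular-region volume bound). [cite: FeldmanSalmhoferTrubowitz1998, App. B (arXiv p.32 L88–96)] -/
theorem card_filter_abs_lt_mul_le_volume (η : ℝ × ℝ → ℝ) {G : ℝ} (hG : 0 ≤ G)
    (hLip : ∀ p q : ℝ × ℝ, |η p - η q| ≤ G * dist p q) (ε : ℝ) :
    ((univ.filter fun k : TorusSite 2 L =>
        |η (2 * Real.pi * ((k 0).val : ℝ) / L, 2 * Real.pi * ((k 1).val : ℝ) / L)| < ε).card : ENNReal) *
        ENNReal.ofReal ((2 * Real.pi / L) ^ 2) ≤
      volume ((Icc (0 : ℝ) (2 * Real.pi + 2 * Real.pi / L) ×ˢ Icc (0 : ℝ) (2 * Real.pi + 2 * Real.pi / L)) ∩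
        {p : ℝ × ℝ | |η p| ≤ ε + G * (2 * Real.pi / L)}) := by
  have hL : (0 : ℝ) < L := by exact_mod_cast Nat.pos_of_ne_zero (NeZero.ne L)
  have hh : 0 < 2 * Real.pi / L := by positivity
  -- the half-open cells of side `2π/L` at the lattice points
  set cell : TorusSite 2 L → Set (ℝ × ℝ) := fun k =>
    Ico (2 * Real.pi * ((k 0).val : ℝ) / L) (2 * Real.pi * ((k 0).val : ℝ) / L + 2 * Real.pi / L) ×ˢ
      Ico (2 * Real.pi * ((k 1).val : ℝ) / L) (2 * Real.pi * ((k 1).val : ℝ) / L + 2 * Real.pi / L) with hcelldef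
  have key : ∀ {a b : ℕ}, a ≠ b → Disjoint (Ico (2 * Real.pi * (a : ℝ) / L) (2 * Real.pi * (a : ℝ) / L + 2 * Real.pi / L))
      (Ico (2 * Real.pi * (b : ℝ) / L) (2 * Real.pi * (b : ℝ) / L + 2 * Real.pi / L)) := by
    intro a b hab
    rw [Set.Ico_disjoint_Ico]
    rcases lt_or_gt_of_ne hab with h | h
    · have h1 : (a : ℝ) + 1 ≤ b := by exact_mod_cast h
      have : 2 * Real.pi * (a : ℝ) / L + 2 * Real.pi / L ≤ 2 * Real.pi * (b : ℝ) / L := by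
        rw [← add_div, div_le_div_iff_of_pos_right hL]; nlinarith [Real.pi_pos]
      exact (min_le_left _ _).trans (this.trans (le_max_right _ _))
    · have h1 : (b : ℝ) + 1 ≤ a := by exact_mod_cast h
      have : 2 * Real.pi * (b : ℝ) / L + 2 * Real.pi / L ≤ 2 * Real.pi * (a : ℝ) / L := by
        rw [← add_div, div_le_div_iff_of_pos_right hL]; nlinarith [Real.pi_pos]
      exact (min_le_right _ _).trans (this.trans (le_max_left _ _))
  have hdisj0 : ∀ {k k' : TorusSite 2 L}, k ≠ k' → Disjoint (cell k) (cell k') := by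
    intro k k' hkk'
    have hne : (k 0).val ≠ (k' 0).val ∨ (k 1).val ≠ (k' 1).val := by
      by_contra h
      push Not at h
      apply hkk'
      funext i
      fin_cases i
      · exact ZMod.val_injective _ h.1
      · exact ZMod.val_injective _ h.2
    simp only [hcelldef, Set.disjoint_prod]
    rcases hne with h0 | h1
    · exact Or.inl (key h0)
    · exact Or.inr (key h1)
  have hvolcell : ∀ k : TorusSite 2 L, volume (cell k) = ENNReal.ofReal ((2 * Real.pi / L) ^ 2) := by
    intro k
    simp only [hcelldef]
    rw [Measure.volume_eq_prod, Measure.prod_prod, Real.volume_Ico, Real.volume_Ico, add_sub_cancel_left,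
      add_sub_cancel_left, ← ENNReal.ofReal_mul hh.le, sq]
  set P := univ.filter fun k : TorusSite 2 L =>
    |η (2 * Real.pi * ((k 0).val : ℝ) / L, 2 * Real.pi * ((k 1).val : ℝ) / L)| < ε with hP
  set S := (Icc (0 : ℝ) (2 * Real.pi + 2 * Real.pi / L) ×ˢ Icc (0 : ℝ) (2 * Real.pi + 2 * Real.pi / L)) ∩
    {p : ℝ × ℝ | |η p| ≤ ε + G * (2 * Real.pi / L)} with hS
  -- each cell lies in `S`
  have hval : ∀ (k : TorusSite 2 L) (i : Fin 2), 2 * Real.pi * ((k i).val : ℝ) / L + 2 * Real.pi / L ≤ 2 * Real.pi + 2 * Real.pi / L := by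
    intro k i
    have h1 : ((k i).val : ℝ) + 1 ≤ L := by exact_mod_cast ZMod.val_lt (k i)
    have : 2 * Real.pi * ((k i).val : ℝ) / L ≤ 2 * Real.pi - 2 * Real.pi / L := by
      rw [le_sub_iff_add_le, ← add_div, div_le_iff₀ hL]; nlinarith [Real.pi_pos]
    linarith
  have hcell : ∀ k ∈ P, cell k ⊆ S := by
    intro k hk p hp
    have hk' := (mem_filter.1 hk).2
    simp only [hcelldef, Set.mem_prod, Set.mem_Ico] at hp
    obtain ⟨⟨h1a, h1b⟩, ⟨h2a, h2b⟩⟩ := hp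
    refine ⟨⟨⟨?_, ?_⟩, ⟨?_, ?_⟩⟩, ?_⟩
    · exact le_trans (by positivity) h1a
    · exact h1b.le.trans (hval k 0)
    · exact le_trans (by positivity) h2a
    · exact h2b.le.trans (hval k 1)
    · -- Lipschitz within the cell (sup metric)
      have hdist : dist p (2 * Real.pi * ((k 0).val : ℝ) / L, 2 * Real.pi * ((k 1).val : ℝ) / L) ≤ 2 * Real.pi / L := by
        rw [Prod.dist_eq, max_le_iff, Real.dist_eq, Real.dist_eq, abs_le, abs_le]
        constructor <;> constructor <;> linarith
      have h := hLip p (2 * Real.pi * ((k 0).val : ℝ) / L, 2 * Real.pi * ((k 1).val : ℝ) / L)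
      have habs := abs_sub_abs_le_abs_sub (η p) (η (2 * Real.pi * ((k 0).val : ℝ) / L, 2 * Real.pi * ((k 1).val : ℝ) / L))
      show |η p| ≤ ε + G * (2 * Real.pi / L)
      nlinarith [mul_le_mul_of_nonneg_left hdist hG]
  -- disjoint union of the cells
  have hdisj : Set.PairwiseDisjoint (↑P : Set (TorusSite 2 L)) cell :=
    fun k _ k' _ hkk' => hdisj0 hkk'
  have hmeas : ∀ k ∈ P, MeasurableSet (cell k) := fun k _ => by
    simp only [hcelldef]
    exact measurableSet_Ico.prod measurableSet_Ico
  calc ((P.card : ENNReal)) * ENNReal.ofReal ((2 * Real.pi / L) ^ 2)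
      = ∑ k ∈ P, volume (cell k) := by
        rw [sum_congr rfl fun k _ => hvolcell k, sum_const, nsmul_eq_mul]
    _ = volume (⋃ k ∈ P, cell k) := (measure_biUnion_finset hdisj hmeas).symm
    _ ≤ volume S := measure_mono (Set.iUnion₂_subset fun k hk => hcell k hk)

/-- **The density-of-states count from a regular band function** (finite-volume form of de Siqueira Pedra–Salmhofer 2008, Lemma 5.1's
`∫|φ| ln(1/max{|E|, π/β})` being finite for a bounded density of states; Feldman–Salmhofer–Trubowitz 1998 App. B regular region):
let `η : ℝ × ℝ → ℝ` be `C²` with `‖D²η‖ ≤ M`, sup-metric Lipschitz constant `G`, and REGULAR near its zero set — `|η p| ≤ r ⇒ 2δ₁ ≤ |∂₁η p| ∨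
2δ₁ ≤ |∂₂η p|`.  Then for `0 ≤ ε` with `ε + 2πG/L ≤ r`, with `s = δ₁/(M+1)` and `n = ⌈(2π + 2π/L)/s⌉₊`:
`#{k⃗ ∈ (ℤ/L)² : |η(2πk⃗/L)| < ε} · (2π/L)² ≤ n²·s·2(ε + 2πG/L)/δ₁` (cells ⊂ band, then the tiling estimate
`volume_regular_le_of_tiling_of_hessian_bound`). [cite: FeldmanSalmhoferTrubowitz1998, App. B (arXiv p.32 L88–96)] -/
theorem card_filter_abs_lt_mul_sq_le (η : ℝ × ℝ → ℝ) (hη : ContDiff ℝ 2 η) {G M δ₁ r : ℝ} (hG : 0 ≤ G) (hM : 0 ≤ M) (hδ₁ : 0 < δ₁)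
    (hLip : ∀ p q : ℝ × ℝ, |η p - η q| ≤ G * dist p q) (hD2 : ∀ p : ℝ × ℝ, ‖fderiv ℝ (fderiv ℝ η) p‖ ≤ M)
    (hreg : ∀ p : ℝ × ℝ, |η p| ≤ r →
      2 * δ₁ ≤ |fderiv ℝ η p ((1 : ℝ), (0 : ℝ))| ∨ 2 * δ₁ ≤ |fderiv ℝ η p ((0 : ℝ), (1 : ℝ))|)
    {ε : ℝ} (hε : 0 ≤ ε) (hεr : ε + G * (2 * Real.pi / L) ≤ r) :
    (((univ.filter fun k : TorusSite 2 L =>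
        |η (2 * Real.pi * ((k 0).val : ℝ) / L, 2 * Real.pi * ((k 1).val : ℝ) / L)| < ε).card : ℕ) : ℝ) *
        (2 * Real.pi / L) ^ 2 ≤
      (⌈(2 * Real.pi + 2 * Real.pi / L) / (δ₁ / (M + 1))⌉₊ : ℝ) * ⌈(2 * Real.pi + 2 * Real.pi / L) / (δ₁ / (M + 1))⌉₊ *
        ((δ₁ / (M + 1)) * (2 * (ε + G * (2 * Real.pi / L)) / δ₁)) := by
  have hL : (0 : ℝ) < L := by exact_mod_cast Nat.pos_of_ne_zero (NeZero.ne L)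
  have hh : 0 < 2 * Real.pi / L := by positivity
  set ε' := ε + G * (2 * Real.pi / L) with hε'
  have hε'0 : 0 ≤ ε' := by positivity
  set s := δ₁ / (M + 1) with hs
  have hs0 : 0 < s := by positivity
  have hMs : M * s ≤ δ₁ := by
    rw [hs, mul_div_assoc']
    rw [div_le_iff₀ (by positivity)]
    nlinarith
  set n := ⌈(2 * Real.pi + 2 * Real.pi / L) / s⌉₊ with hn
  have hbox : 2 * Real.pi + 2 * Real.pi / L ≤ n * s := by
    have := Nat.le_ceil ((2 * Real.pi + 2 * Real.pi / L) / s)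
    rw [div_le_iff₀ hs0] at this
    exact this
  have hnpos : 0 < n := by
    have h1 : (0 : ℝ) < n * s := lt_of_lt_of_le (by positivity) hbox
    have h2 : (0 : ℝ) < n := pos_of_mul_pos_left h1 hs0.le
    exact_mod_cast h2
  -- the band on the big box
  set A := Icc (0 : ℝ) (2 * Real.pi + 2 * Real.pi / L) ×ˢ Icc (0 : ℝ) (2 * Real.pi + 2 * Real.pi / L) with hA
  have hA' : A ⊆ Icc (0 : ℝ) (0 + n * s) ×ˢ Icc (0 : ℝ) (0 + n * s) := by
    rw [zero_add]
    exact Set.prod_mono (Icc_subset_Icc le_rfl hbox) (Icc_subset_Icc le_rfl hbox)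
  have hvol := FermiRG.volume_regular_le_of_tiling_of_hessian_bound (η := η) hη (a := 0) (c := 0) hnpos hnpos hs0 hδ₁ hε'0 hMs
    (fun p _ => hD2 p) hA' 0 (fun p _ hp => hreg p (by rw [zero_add] at hp; exact hp.trans hεr))
  -- `|0 + η| ≤ ε'` is `|η| ≤ ε'`
  have hset : A ∩ {p : ℝ × ℝ | |0 + η p| ≤ ε'} = A ∩ {p : ℝ × ℝ | |η p| ≤ ε + G * (2 * Real.pi / L)} := by
    ext p; simp [hε']
  rw [hset] at hvol
  have hcells := card_filter_abs_lt_mul_le_volume (L := L) η hG hLip ε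
  have hfin := hcells.trans hvol
  -- back to the reals
  have hX : 0 ≤ (n : ℝ) * n * (s * (2 * ε' / δ₁)) := by positivity
  rw [← ENNReal.ofReal_natCast, ← ENNReal.ofReal_mul (Nat.cast_nonneg _), ENNReal.ofReal_le_ofReal_iff hX] at hfin
  simpa [hn, hs, hε'] using hfin

end Literature.MathematicalPhysics.QuantumLattice

end
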